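import Summits.BirchSwinnertonDyer.Rank1Residual.Additive.CensusX42BSD
import HarnessLib

/-!
# Census relation X4-2: the ONE-NODE theorem — X3♯(G-ord) twins (Wuthrich's half), the Gross–Zagier-fed
# form, and the form for THE census height (sequel of `CensusX42BSD.lean`; cell `b2b-bsdres`, census
# cell `bsd-formula-census`, seat `b2b-bsdres-census-ctyper1` = conjecture-typer 1, gen 3)

HONEST FRAMING (cell `b2b-bsdres`, run/shared/lean/b2b/bsd-rank1-residual/, verbatim in every
file): the goal of the cell is to DELETE the COMBINATION-SHAPED residual classes of the
Birch–Swinnerton-Dyer formula for ALL analytic-rank `≤ 1` elliptic curves over `ℚ` — "full BSD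
formula for every rank `≤ 1` curve in class `C`" assembled STRICTLY from published theorems — so
that the rank-`≤ 1` remainder becomes exactly the CONSTRUCTION-SHAPED classes, which are TYPED
(missing-input `Prop`s), NOT attempted. This is not "finishing BSD". Census cell
(bsd-formula-census): research instrumentation; census output = EVIDENCE / conjecture items for the
kernel cell, never a Literature fact; `r = 0` cells CALIBRATION, `r = 1` cells CANDIDATE = EVIDENCE,
never a cited fact; nothing here 'confirms' anything; labels / RESIDUAL-MAP marks UNCHANGED (O7-ord
OPEN, X4♯(G-ord) / X3♯(G-ord) CONSTRUCTION-SHAPED); nothing booked. THEOREMS ONLY (no definition, no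
named fact); every statement is CONDITIONAL on the named published facts in its binders, on the
one-number certificate `BranchUnitCertificateAt W p`, and on the TYPED CENSUS RELATION
`CensusX42.RelationAt W p Dh` AT THE PAIR (CANDIDATE; X42-REPORT.md sha256
`e8592c9a2e1a59c13e754928288c9f6b1ce554f7ffb80b93db3c55aa7f5e9950`; EVIDENCE block in
`CensusX42LeadingTerm.lean`). See the module docstring of `CensusX42BSD.lean` for the chain and for
the note ON THE HEIGHT DATUM (one `Dh` carrying both the (B)-clauses and the census relation; that the
census height is Delbourgo's `⟨,⟩_{p,ℚ}` on Gord2 is rmap-2 g9's page-read READING, never asserted).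

Contents: §3 `ClassX3Gord.bsdp_of_censusX42_of_wuthrichHalf_of_cert` (+ `_of_shaAn_unit`) — the
X3♯(G-ord) ∩ `I₀*` twins (the census universe is image-blind; `RelationAt` has no image hypothesis);
§4 `ClassX4Gord.bsdp_of_forall_censusX42_of_katoHalf_of_cert` (THE (B)-datum from A175, `#Ш_an ∈ ℚ`
from Gross–Zagier I.(7.3): published facts + certificate + census relation, nothing else) and
`ClassX4Gord.bsdp_of_censusX42Height_of_katoHalf_of_cert` (gen 2's `RelationAtCensusHeight`).

References: D. Delbourgo, J. Number Theory 95 (2002) Thm. (A), (B) [Delbourgo2002]; K. Kato,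
Astérisque 295 (2004) Thm. 17.4 (3) [Kato2004Asterisque]; C. Wuthrich, Doc. Math. 19 (2014) Thm. 16
[Wuthrich2014]; B. Gross, D. Zagier, Invent. Math. 84 (1986) Thm. I.(7.3) [GrossZagier1986];
B. Mazur, W. Stein, J. Tate, Doc. Math. Extra Vol. (2006) [MazurSteinTate2006]; R. L. Miller, LMS
J. Comput. Math. 14 (2011) Def. 1.1 [Miller2011LMS].
-/

noncomputable section

open scoped Classical MatrixGroups ModularForm NumberField

namespace Summit.BirchSwinnertonDyer.Rank1Residual.Additive

open CongruenceSubgroup WeierstrassCurve NumberField Literature.NumberTheory.EllipticCurves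
  Literature.NumberTheory.EllipticCurves.ModularForms
  Literature.NumberTheory.EllipticCurves.Rank1Residual
  Literature.NumberTheory.EllipticCurves.Rank1Residual.Typed
  Literature.NumberTheory.EllipticCurves.Delbourgo2002
  Literature.NumberTheory.GaloisRepresentations Summit.BirchSwinnertonDyer.Rank1Residual.AdditivePotMult
  IsDedekindDomain

open CensusX42

variable {p : ℕ} [hp : Fact p.Prime]

variable {W : WeierstrassCurve ℚ} [W.IsElliptic] [W.IsGloballyMinimal]

/-! ### §3 X3♯(G-ord) ∩ `I₀*` twins (Wuthrich's reducible half; the census universe is image-blind) -/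

/-- **ONE NODE, X3 twin (X3♯(G-ord) ∩ `I₀*`, `p ≥ 5`, `r_an = 1`, non-anomalous):** Wuthrich's
component divisibility (`hWu`, `E[p]` reducible), modularity, GZK, the one-number certificate, a
(B)-datum `Dh`, `L'(E,1) = q·Ω_E·Reg_∞`, and the typed census relation `CensusX42.RelationAt W p Dh`
AT THE PAIR ⟹ `BSD(E,p)`. CONDITIONAL on `hrel` (CANDIDATE; EVIDENCE only).
[cite: Wuthrich2014, Thm. 16 (p. 397)] [cite: Delbourgo2002, Theorem (B) (p. 40)]
[cite: Miller2011LMS, Def. 1.1] -/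
theorem ClassX3Gord.bsdp_of_censusX42_of_wuthrichHalf_of_cert
    (hWu : Wuthrich2014.thm16_halfEigenCharIdeal_dvd_cyclotomicPrime)
    (hmodD : nonempty_modularParametrizationData)
    (hGZK : rank_eq_analyticRank_of_analyticRank_le_one) (hmod : hasEntireLFunction_rat)
    (hX : ClassX3Gord W p) (hp5 : 5 ≤ p) (he : semistabilityIndex W p = 2)
    (hr : W.analyticRank = 1) (hna : ReductionNonAnomalous W p) (hcert : BranchUnitCertificateAt W p)
    {Dh : PAdicHeightData W p} (hB : LeadingTermClauses W p Dh) (hrel : RelationAt W p Dh)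
    {q : ℚ} (hLq : W.leadingLCoeff = (q : ℂ) * (W.realPeriodRat : ℂ) * (W.regulator : ℂ)) :
    BSDp W p := by
  rw [hX.bsdp_iff_padicVal_rankOne_of_wuthrichHalf_of_cert hWu hmodD hGZK hmod hp5 he hr hna hcert hB
    hLq]
  have hp2 : p ≠ 2 := by omega
  have hq : q ≠ 0 := by
    rintro rfl
    rw [Rat.cast_zero, zero_mul, zero_mul] at hLq
    exact W.leadingLCoeff_ne_zero_holds (hmod W) hLq
  obtain ⟨V, iV, iVm, C, hV, hC⟩ := hX.exists_goodOrd_pStar_twist_model W p hp2 he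
  haveI : NeZero (V.conductorNorm ℤ) := ⟨(V.conductorNorm_pos_holds).ne'⟩
  obtain ⟨Dm⟩ := hmodD V
  obtain ⟨ϖ, hϖ⟩ := exists_periodRatio_parity (p := p) V Dm
  have hord : IsOrdinaryAt V p := hV
  obtain ⟨-, hone⟩ := hcert V C hC hord Dm.f Dm.isNewformOf ϖ hϖ
  exact (padicValRat_add_valuation_eq_one_of_relationAt hp2 hX.addv hr hq hLq V C hC hord
    Dm.isNewformOf ϖ hϖ hone hrel).2

/-- **ONE NODE, X3 twin, `#Ш_an`-unit rows (no non-anomalous binder):** X3♯(G-ord) ∩ `I₀*`, `p ≥ 5`,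
`r_an = 1`, certificate, Wuthrich half, a (B)-datum, `#Ш_an = s` with `ord_p s = 0`, and the census
relation at the pair ⟹ `BSD(E,p)` and `ℓ = 1` in the exact identity.
[cite: Wuthrich2014, Thm. 16 (p. 397)] [cite: Delbourgo2002, Theorem (B) (p. 40)]
[cite: Miller2011LMS, Def. 1.1] -/
theorem ClassX3Gord.bsdp_of_censusX42_of_wuthrichHalf_of_cert_of_shaAn_unit
    (hWu : Wuthrich2014.thm16_halfEigenCharIdeal_dvd_cyclotomicPrime)
    (hmodD : nonempty_modularParametrizationData)
    (hGZK : rank_eq_analyticRank_of_analyticRank_le_one) (hmod : hasEntireLFunction_rat)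
    (hX : ClassX3Gord W p) (hp5 : 5 ≤ p) (he : semistabilityIndex W p = 2)
    (hr : W.analyticRank = 1) (hcert : BranchUnitCertificateAt W p)
    {Dh : PAdicHeightData W p} (hB : LeadingTermClauses W p Dh) (hrel : RelationAt W p Dh)
    {s : ℚ} (hs : shaAn W = (s : ℂ)) (hsv : padicValRat p s = 0) :
    BSDp W p ∧
      (padicValNat p W.shaOrder : ℤ) + (padicRegulator Dh).valuation +
          padicValNat p W.tamagawaProduct = 1 + 2 * padicValNat p W.torsionOrder := by
  have hp2 : p ≠ 2 := by omega
  have hLq := leadingLCoeff_eq_of_shaAn_eq W hs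
  set q : ℚ := s * W.tamagawaProduct / (W.torsionOrder : ℚ) ^ 2 with hq_def
  have hq : q ≠ 0 := by
    rintro h0
    rw [h0, Rat.cast_zero, zero_mul, zero_mul] at hLq
    exact W.leadingLCoeff_ne_zero_holds (hmod W) hLq
  have hTq : (W.torsionOrder : ℚ) ≠ 0 := by exact_mod_cast (W.torsionOrder_pos_holds).ne'
  have hPq : (W.tamagawaProduct : ℚ) ≠ 0 := by
    exact_mod_cast (W.tamagawaProduct_pos_holds : 0 < W.tamagawaProduct).ne'
  have hs0 : s ≠ 0 := by
    rintro rfl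
    exact hq (by rw [hq_def, zero_mul, zero_div])
  obtain ⟨V, iV, iVm, C, hV, hC⟩ := hX.exists_goodOrd_pStar_twist_model W p hp2 he
  haveI : NeZero (V.conductorNorm ℤ) := ⟨(V.conductorNorm_pos_holds).ne'⟩
  obtain ⟨Dm⟩ := hmodD V
  obtain ⟨ϖ, hϖ⟩ := exists_periodRatio_parity (p := p) V Dm
  have hord : IsOrdinaryAt V p := hV
  obtain ⟨-, hone⟩ := hcert V C hC hord Dm.f Dm.isNewformOf ϖ hϖ
  obtain ⟨-, hcensus⟩ := padicValRat_add_valuation_eq_one_of_relationAt hp2 hX.addv hr hq hLq V C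
    hC hord Dm.isNewformOf ϖ hϖ hone hrel
  obtain ⟨-, ℓ, hℓp, -, hid⟩ :=
    hX.schneider_and_padicVal_identity_rankOne_of_wuthrichHalf_of_cert hWu hmodD hGZK hp5 he hr hcert hB
  have hqval : padicValRat p q =
      padicValRat p s + padicValNat p W.tamagawaProduct - 2 * padicValNat p W.torsionOrder := by
    rw [hq_def, padicValRat.div (mul_ne_zero hs0 hPq) (pow_ne_zero 2 hTq), padicValRat.mul hs0 hPq,
      padicValRat.pow, padicValRat.of_nat, padicValRat.of_nat]
    push_cast
    ring
  have hℓ0 : (padicValNat p ℓ : ℤ) = 0 := by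
    have h1 : (0 : ℤ) ≤ padicValNat p ℓ := by positivity
    have h2 : (0 : ℤ) ≤ padicValNat p W.shaOrder := by positivity
    rw [hsv] at hqval
    linarith
  refine ⟨?_, by linarith⟩
  have hid' : (padicValNat p W.shaOrder : ℤ) + ((padicRegulator Dh).valuation + padicValNat p ℓ) +
      padicValNat p W.tamagawaProduct = 1 + 2 * padicValNat p W.torsionOrder := by linarith
  rw [bsdp_iff_padicValRat_add_eq_one (W := W) (p := p) hGZK (by rw [hr]) hq hLq hid']
  linarith

/-! ### §4 Fed by Gross–Zagier (`#Ш_an ∈ ℚ`) and for THE census height -/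

/-- **ONE NODE from published facts + the certificate + the census relation alone** (X4♯(G-ord) ∩
`I₀*` ∩ {`ρ̄` onto}, `p ≥ 5`, `E` non-CM, `r_an = 1`, non-anomalous): Kato 17.4 (3) (`hK`),
Delbourgo 2002 (A)+(B) (`hDel` = A175, supplying THE (B)-datum), Gross–Zagier I.(7.3) (`hGZ`), GZK,
modularity, the one-number certificate, and `CensusX42.RelationAt W p Dh` for EVERY (B)-datum `Dh`
(`hrel`; in particular for Delbourgo's `⟨,⟩_{p,ℚ}` — on the Gord2 rows the census height IS that
pairing by rmap-2 g9's page-read reading, see the module docstring) ⟹ `BSD(E,p)`.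
[cite: Kato2004Asterisque, Thm. 17.4 (3) (p. 273)] [cite: Delbourgo2002, Theorem (A), (B) (p. 40)]
[cite: GrossZagier1986, Thm. I.(7.3)] [cite: Miller2011LMS, Def. 1.1] -/
theorem ClassX4Gord.bsdp_of_forall_censusX42_of_katoHalf_of_cert
    (hDel : Delbourgo2002.mainTheorem)
    (hK : Wuthrich2014.kato_halfEigenCharIdeal_dvd_cyclotomicPrime_of_surjective)
    (hGZ : GrossZagier1986_thm_I_7_3) (hmodD : nonempty_modularParametrizationData)
    (hGZK : rank_eq_analyticRank_of_analyticRank_le_one) (hmod : hasEntireLFunction_rat)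
    (hX : ClassX4Gord W p) (hp5 : 5 ≤ p) (hcm : ¬ W.HasCM) (he : semistabilityIndex W p = 2)
    (hsurj : Surj W p) (hr : W.analyticRank = 1) (hna : ReductionNonAnomalous W p)
    (hcert : BranchUnitCertificateAt W p)
    (hrel : ∀ Dh : PAdicHeightData W p, LeadingTermClauses W p Dh → RelationAt W p Dh) :
    BSDp W p := by
  have hadd : ¬ W.HasGoodReductionAtPrime p ∧ ¬ W.HasMultiplicativeReductionAtPrime p := hX.addv.2
  obtain ⟨Dh, hB⟩ := Delbourgo2002.mainTheorem.exists_leadingTermClauses hDel hp5 hcm hadd hX.typeGOrd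
  obtain ⟨q, -, hLq⟩ := exists_leadingLCoeff_eq_of_grossZagier hGZ hGZK W hr
  exact hX.bsdp_of_censusX42_of_katoHalf_of_cert hK hmodD hGZK hmod hp5 he hsurj hr hna hcert hB
    (hrel Dh hB) hLq

/-- **ONE NODE for THE census height** (gen 2's `RelationAtCensusHeight W p`, scope `p ≥ 5`,
`j(E) ∉ {0, 1728}`): X4♯(G-ord) ∩ `I₀*` ∩ {`ρ̄` onto}, `p ≥ 5`, `r_an = 1`, non-anomalous, the
certificate, Kato half, GZK, modularity, `L'(E,1) = q·Ω_E·Reg_∞`, a good ORDINARY `V` with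
`C • V^{(±p)} = W`, and a height datum `Dh` that IS the twist-transported sigma height of the census
(`IsTwistSigmaHeight W p V Dh`) AND carries Delbourgo's (B)-clauses (`hB` — the rmap-2 g9 READING on
Gord2, entered as a hypothesis) ⟹ `BSD(E,p)` from `RelationAtCensusHeight W p` at the pair.
[cite: MazurSteinTate2006, Thm. 1.3] [cite: Delbourgo2002, Theorem (B) (p. 40)]
[cite: Kato2004Asterisque, Thm. 17.4 (3) (p. 273)] [cite: Miller2011LMS, Def. 1.1] -/
theorem ClassX4Gord.bsdp_of_censusX42Height_of_katoHalf_of_cert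
    (hK : Wuthrich2014.kato_halfEigenCharIdeal_dvd_cyclotomicPrime_of_surjective)
    (hmodD : nonempty_modularParametrizationData)
    (hGZK : rank_eq_analyticRank_of_analyticRank_le_one) (hmod : hasEntireLFunction_rat)
    (hX : ClassX4Gord W p) (hp5 : 5 ≤ p) (he : semistabilityIndex W p = 2) (hsurj : Surj W p)
    (hr : W.analyticRank = 1) (hna : ReductionNonAnomalous W p) (hcert : BranchUnitCertificateAt W p)
    (hRC : RelationAtCensusHeight W p) (h4 : W.c₄ ≠ 0) (h6 : W.c₆ ≠ 0)
    {V : WeierstrassCurve ℚ} [V.IsElliptic] [V.IsGloballyMinimal] {C : VariableChange ℚ}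
    (hord : IsOrdinaryAt V p)
    (hC : C • V.quadraticTwist (p : ℚ) = W ∨ C • V.quadraticTwist (-(p : ℚ)) = W)
    {Dh : PAdicHeightData W p} (hDh : IsTwistSigmaHeight W p V Dh) (hB : LeadingTermClauses W p Dh)
    {q : ℚ} (hLq : W.leadingLCoeff = (q : ℂ) * (W.realPeriodRat : ℂ) * (W.regulator : ℂ)) :
    BSDp W p :=
  hX.bsdp_of_censusX42_of_katoHalf_of_cert hK hmodD hGZK hmod hp5 he hsurj hr hna hcert hB
    (relationAt_of_relationAtCensusHeight hRC hp5 h4 h6 hord hC hDh) hLq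

end Summit.BirchSwinnertonDyer.Rank1Residual.Additive

end
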